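import Literature.NumberTheory.EllipticCurves.TwoDescentLocalSelmerOfExhibit
import Literature.NumberTheory.EllipticCurves.TwoDescentLinearConditions
import Literature.NumberTheory.EllipticCurves.TwoDescentLocalI0
import Literature.NumberTheory.EllipticCurves.CongruentNumberCurveMinimalAtTwo
import Literature.NumberTheory.QuadraticForms.HilbertSymbolRatOdd
import HarnessLib

/-!
# Local solubility for the complete `2`-descent on `E_n : y² = x³ − n²x` — the `≥` half, place by place

For the congruent number curve `E_n : y² = (x + n)·x·(x − n)` over `ℚ` (`e₁ = −n`, `e₂ = 0`, `e₃ = n`;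
`T₁ = (−n, 0)`, `T₂ = (0, 0)`) and a pair `(a, b) ∈ (ℚˣ)²`, let `c(a, b) = twoDescentClass (a, b) ∈ H¹(ℚ, E_n[2])`
be THE class with components `([a], [b])` (`TwoDescentClassOfPair.lean`). A complete `2`-descent computes
`Sel⁽²⁾(E_n/ℚ) = {(a, b) : (a, b) ∈ δ(E_n(ℚ_v)) for all v}` (Silverman, *AEC*, Prop. X.1.4 / X.4.9). The
upper-bound files of the cell `bsd-monsky` (`CongruentNumber{EvenFive,EvenMonsky,OddMonsky}SelmerBound*`)
derive NECESSARY local conditions; this file proves the SUFFICIENT ones — **at each place `v`, explicit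
conditions on `(a, b)` under which `c(a, b)` satisfies the local Selmer condition at `v`** (lies in
`selmerLocalKer`, i.e. `res_v c ∈ 𝓛_v = im(E_n(ℚ_v)/2 → H¹(ℚ_v, E_n[2]))`), by EXHIBITING a point of
`E_n(ℚ_v)` with descent pair `([a]_v, [b]_v)` (`TwoDescentLocalExhibits.lean`) and the converse bridge
(`TwoDescentKummerBridgeConverse.lean`):

* §1 the GOOD odd primes `ℓ ∤ 2n`: `a, b` integers prime to `ℓ` (`…_of_not_dvd`; Kummer-unramified +
  Gross (7.1), `TwoDescentClassOfPair.lean`);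
* §2 the ODD primes `ℓ ∥ n` (type `I₀*`): the two `𝔽₂`-relations
  `qr_ℓ(a) = α·qr_ℓ(n) + β·qr_ℓ(2)`, `qr_ℓ(b) = α·qr_ℓ(−1) + β·(qr_ℓ(−1) + qr_ℓ(n))` (`α = v_ℓ(a)`,
  `β = v_ℓ(b) mod 2`) — EXACTLY the necessary relations of `TwoDescentKummerBridgeAdditivePlace.lean` — are
  sufficient: they say that `([a]_ℓ, [b]_ℓ)` is the descent pair of the torsion point `O, T₁, T₂, T₃`
  selected by `(α, β)` (`…_of_qrBit_rel`; Serre II §3.3 Thm 3 as the square test);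
* §3 the prime `2` for EVEN `n ≡ 2 (mod 4)`: `([a]₂, [b]₂) = (1, 1)` (`a ≡ b ≡ 1 (mod 8)` odd: the point `O`,
  `…_two_of_res8_eq_one`) or `= ([5 + n], [5])` (the `2`-adic point `(5, √(125 − 5n²))` of `E_n(ℚ₂)`,
  `125 − 5n² ≡ 1 (mod 8)`; `…_two_of_res8_mul_eq_one`; Serre II §3.3 Thm 4);
* §4 the REAL place: `a > 0` (the points `O` for `b > 0`, `T₂` for `b < 0`; `…_infinitePlace_of_pos`);
* §5 the ASSEMBLY `twoDescentClass_mem_selmerGroup_of_local`: `c(a, b) ∈ Sel⁽²⁾(E_n/ℚ)` from `a > 0`,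
  integrality/coprimality at the good primes, the relations at the odd `ℓ ∣ n`, and the `2`-adic condition
  (left as a hypothesis on the place above `2`, supplied by §3 for even `n` and by the odd-`n` sequel).

The passage from an exhibited point to the local condition (`TwoDescentLocalSelmerOfExhibit.lean`) is stated
over a GENERIC `ℚ`-field `E` with `CharZero E` a plain hypothesis, so that no `CharZero` instance on a
completion of `ℚ` re-routes `algebraMap ℚ ℚ_v` through `Rat.cast`; here that hypothesis is always passed as a
term. Theorems only; no named fact. Cell `bsd-monsky` (prover-B): the local
half of the `≥` direction of Monsky's `2`-Selmer formula `#Sel⁽²⁾(E_n/ℚ) = 2^{2+s(n)}` (appendix to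
Heath-Brown, Invent. Math. 118 (1994)).

## References

* [SilvermanAEC2009] J. H. Silverman, *The Arithmetic of Elliptic Curves*, 2nd ed., GTM 106, Springer
  2009, Prop. X.1.4, Example X.1.5, Prop. X.4.9.
* [HeathBrown1994SelmerCongruentII] D. R. Heath-Brown, Invent. Math. 118 (1994) 331–370, Appendix
  (P. Monsky), typescript p. 38 L24–L31 (the local conditions at `p ∣ D`), p. 41 L1–L19.
* [Serre1973] J.-P. Serre, *A Course in Arithmetic*, Ch. II §3.3 Thm 3, Thm 4.
-/

noncomputable section

open scoped Classical

open WeierstrassCurve WeierstrassCurve.Affine WeierstrassCurve.Affine.Point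
open Literature.NumberTheory.GaloisRepresentations
open Literature.NumberTheory.EllipticCurves.KramerTwoDescent
open Literature.NumberTheory.EllipticCurves.TwoDescentLocal
open Literature.NumberTheory.QuadraticForms
open IsDedekindDomain NumberField Rat.HeightOneSpectrum

namespace Literature.NumberTheory.EllipticCurves

namespace CongruentNumberTwoDescent

variable {n : ℕ} [hE : (congruentNumberCurve n).IsElliptic]

/-! ## §0 Bookkeeping in `ℤ/2` and on valuations -/

/-- `x + x = 0` in `ℤ/2`. [folklore] -/
private theorem add_self_zmod2 (x : ZMod 2) : x + x = 0 := by revert x; decide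

/-- The two values of a bit. [folklore] -/
private theorem zmod2_cases (x : ZMod 2) : x = 0 ∨ x = 1 := by revert x; decide

/-- `parityBit ℓ (−x) = parityBit ℓ x`. [folklore] -/
private theorem parityBit_neg (ℓ : ℕ) (x : ℚ) : parityBit ℓ (-x) = parityBit ℓ x := by
  unfold parityBit; rw [padicValRat.neg]

/-- `parityBit ℓ 1 = 0`. [folklore] -/
private theorem parityBit_one (ℓ : ℕ) : parityBit ℓ (1 : ℚ) = 0 := by
  unfold parityBit; rw [padicValRat.one]; rfl

/-- `parityBit ℓ 2 = 0` for an odd prime `ℓ`. [folklore] -/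
private theorem parityBit_two {ℓ : ℕ} [Fact ℓ.Prime] (hℓ2 : ℓ ≠ 2) : parityBit ℓ (2 : ℚ) = 0 := by
  unfold parityBit
  rw [show (2 : ℚ) = ((2 : ℕ) : ℚ) from rfl, padicValRat.of_nat, padicValNat_primes hℓ2]
  simp

/-- `ℚ_v` has characteristic zero (a term, deliberately NOT a local instance). [folklore] -/
private theorem charZero_adicCompletion_rat (v : HeightOneSpectrum (𝓞 ℚ)) : CharZero (v.adicCompletion ℚ) :=
  charZero_of_injective_algebraMap (algebraMap ℚ (v.adicCompletion ℚ)).injective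

/-- `ℚ_w` has characteristic zero (a term, not a local instance). [folklore] -/
private theorem charZero_completion_rat (w : InfinitePlace ℚ) : CharZero w.Completion :=
  charZero_of_injective_algebraMap (algebraMap ℚ w.Completion).injective

/-! ## §1 The good odd primes `ℓ ∤ 2n` -/

omit hE in
/-- `E_n` has good reduction at every `ℓ ∤ 2n` (`Δ = 64 n⁶`). [folklore] -/
private theorem hasGoodReductionAt_cn (v : HeightOneSpectrum (𝓞 ℚ)) (hℓ : ¬ (primesEquiv v : ℕ) ∣ 2 * n) :
    (congruentNumberCurve n).HasGoodReductionAt v := by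
  rw [← map_congruentNumberCurveInt_intCast]
  exact hasGoodReductionAt_map_of_not_dvd _ v
    (not_dvd_congruentNumberCurveInt_Δ_of_not_dvd (primesEquiv v).2 hℓ)

/-- An integer prime to `ℓ = primesEquiv v` is not in `v`. [folklore] -/
private theorem intCast_not_mem (v : HeightOneSpectrum (𝓞 ℚ)) {m : ℤ} (hm : ¬ ((primesEquiv v : ℕ) : ℤ) ∣ m) :
    (m : 𝓞 ℚ) ∉ v.asIdeal := by
  rw [RatPlace.intCast_mem_asIdeal_iff]; exact hm

/-- **Good odd primes.** At a finite place `v` of `ℚ` over `ℓ ∤ 2n`, the class `c(a, b)` of a pair of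
integers `a = m`, `b = m'` prime to `ℓ` satisfies the local Selmer condition (Silverman X.1.4: `v ∉ S` and
`ord_v(b₁) = ord_v(b₂) = 0` ⟹ `(b₁, b₂) ∈ δ(E(K_v))`; by Kummer-unramified + Gross (7.1),
`twoDescentClass_mem_selmerLocalKer_of_not_mem`). [cite: SilvermanAEC2009, Prop. X.1.4, Cor. X.4.4] -/
theorem twoDescentClass_mem_selmerLocalKer_of_not_dvd (v : HeightOneSpectrum (𝓞 ℚ))
    (hℓ : ¬ (primesEquiv v : ℕ) ∣ 2 * n) (a b : ℚˣ) (m m' : ℤ) (hm : (a : ℚ) = m) (hm' : (b : ℚ) = m')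
    (hℓm : ¬ ((primesEquiv v : ℕ) : ℤ) ∣ m) (hℓm' : ¬ ((primesEquiv v : ℕ) : ℤ) ∣ m') :
    (congruentNumberCurve n).twoDescentClass (splitTwoTorsion_cn n) a b ∈
      selmerLocalKer (congruentNumberCurve n) (v.adicCompletion ℚ) 2 := by
  have hgood := hasGoodReductionAt_cn v hℓ
  have h2 : (2 : 𝓞 ℚ) ∉ v.asIdeal := by
    have h := intCast_not_mem v (m := 2) (fun hd => hℓ (dvd_mul_of_dvd_left (by exact_mod_cast hd) n))
    simpa using h
  have hma0 : ((m : 𝓞 ℚ) : ℚ) ≠ 0 := by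
    rw [show ((m : 𝓞 ℚ) : ℚ) = (m : ℚ) by simp, ← hm]; exact a.ne_zero
  have hmb0 : ((m' : 𝓞 ℚ) : ℚ) ≠ 0 := by
    rw [show ((m' : 𝓞 ℚ) : ℚ) = (m' : ℚ) by simp, ← hm']; exact b.ne_zero
  have key := (congruentNumberCurve n).twoDescentClass_mem_selmerLocalKer_of_not_mem (splitTwoTorsion_cn n)
    hgood h2 (intCast_not_mem v hℓm) (intCast_not_mem v hℓm') hma0 hmb0
  have hua : Units.mk0 ((m : 𝓞 ℚ) : ℚ) hma0 = a := Units.ext (by simp [hm])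
  have hub : Units.mk0 ((m' : 𝓞 ℚ) : ℚ) hmb0 = b := Units.ext (by simp [hm'])
  rwa [hua, hub] at key

/-! ## §2 The odd primes `ℓ ∥ n`: the two relations select a `2`-torsion point -/

/-- **Odd primes `ℓ ∥ n` (type `I₀*`): the relations are sufficient.** Let `v` be a finite place of `ℚ`
over an odd prime `ℓ` with `v_ℓ(n) = 1`, and `(a, b) ∈ (ℚˣ)²` with `α = v_ℓ(a)`, `β = v_ℓ(b) (mod 2)`
satisfying `qr_ℓ(a) = α·qr_ℓ(n) + β·qr_ℓ(2)` and `qr_ℓ(b) = α·qr_ℓ(−1) + β·(qr_ℓ(−1) + qr_ℓ(n))`. Then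
`c(a, b)` satisfies the local Selmer condition at `v`: `([a]_ℓ, [b]_ℓ)` is the descent pair of `O`, `T₁`,
`T₂`, `T₃` according as `(α, β) = (0,0), (0,1), (1,0), (1,1)` (descent values `(1,1)`, `(2n², −n)`,
`(n, −n²)`, `(2n, n)`; Serre II §3.3 Thm 3 decides the square classes). These are the printed conditions
at `p ∣ D` of Monsky's appendix / Heath-Brown 1993 §2, in the converse direction.
[cite: SilvermanAEC2009, Prop. X.1.4, Example X.1.5]
[cite: HeathBrown1994SelmerCongruentII, Appendix (Monsky), typescript p. 38 L24–L31] -/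
theorem twoDescentClass_mem_selmerLocalKer_of_qrBit_rel (v : HeightOneSpectrum (𝓞 ℚ)) {ℓ : ℕ} [Fact ℓ.Prime]
    (hv : (primesEquiv v : ℕ) = ℓ) (hℓ2 : ℓ ≠ 2) (hn : padicValRat ℓ (n : ℚ) = 1) (a b : ℚˣ)
    (R1 : qrBit ℓ (a : ℚ) = parityBit ℓ (a : ℚ) * qrBit ℓ (n : ℚ) + parityBit ℓ (b : ℚ) * qrBit ℓ 2)
    (R2 : qrBit ℓ (b : ℚ) =
      parityBit ℓ (a : ℚ) * qrBit ℓ (-1) + parityBit ℓ (b : ℚ) * (qrBit ℓ (-1) + qrBit ℓ (n : ℚ))) :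
    (congruentNumberCurve n).twoDescentClass (splitTwoTorsion_cn n) a b ∈
      selmerLocalKer (congruentNumberCurve n) (v.adicCompletion ℚ) 2 := by
  set W := congruentNumberCurve n with hW
  have hT := splitTwoTorsion_cn n
  have hn0 : (n : ℚ) ≠ 0 := by intro h; rw [h, padicValRat.zero] at hn; exact zero_ne_one hn
  have ha0 : (a : ℚ) ≠ 0 := a.ne_zero
  have hb0 : (b : ℚ) ≠ 0 := b.ne_zero
  -- bits of the constants
  have pn : parityBit ℓ (n : ℚ) = 1 := by unfold parityBit; rw [hn]; rfl
  have p2 : parityBit ℓ (2 : ℚ) = 0 := parityBit_two hℓ2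
  have pm1 : parityBit ℓ (-1 : ℚ) = 0 := by rw [parityBit_neg]; exact parityBit_one ℓ
  have q1 : qrBit ℓ (1 : ℚ) = 0 := qrBit_one (p := ℓ)
  -- the square test on a product `x · c`, in `ℚ_v`
  have sq : ∀ {x c : ℚ}, x ≠ 0 → c ≠ 0 → parityBit ℓ x + parityBit ℓ c = 0 → qrBit ℓ x + qrBit ℓ c = 0 →
      IsSquare (algebraMap ℚ (v.adicCompletion ℚ) (x * c)) := fun hx hc hp hq =>
    isSquare_algebraMap_adicCompletion_of_bits v hv hℓ2 (mul_ne_zero hx hc) (by rwa [parityBit_mul hx hc])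
      (by rwa [qrBit_mul ℓ hx hc])
  -- the four cases `(α, β)`
  rcases zmod2_cases (parityBit ℓ (a : ℚ)) with hα | hα <;>
    rcases zmod2_cases (parityBit ℓ (b : ℚ)) with hβ | hβ <;>
    simp only [hα, hβ, one_mul, zero_mul, add_zero, zero_add] at R1 R2
  · -- `(0, 0)`: the point `O`
    refine twoDescentClass_mem_selmerLocalKer_of_isSquare W hT _ (charZero_adicCompletion_rat v) a b ?_ ?_
    · have := sq ha0 one_ne_zero (by rw [hα, parityBit_one, add_zero]) (by rw [R1, q1, add_zero])
      rwa [mul_one] at this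
    · have := sq hb0 one_ne_zero (by rw [hβ, parityBit_one, add_zero]) (by rw [R2, q1, add_zero])
      rwa [mul_one] at this
  · -- `(0, 1)`: the point `T₁ = (−n, 0)`, descent values `(2n², −n)`
    refine twoDescentClass_mem_selmerLocalKer_of_isSquare_T₁ W hT _ (charZero_adicCompletion_rat v) a b ?_ ?_
    · rw [show (-(n : ℚ) - 0) * (-(n : ℚ) - (n : ℚ)) = 2 * ((n : ℚ) * n) by ring]
      exact sq ha0 (mul_ne_zero two_ne_zero (mul_ne_zero hn0 hn0))
        (by rw [hα, parityBit_mul two_ne_zero (mul_ne_zero hn0 hn0), p2, parityBit_mul hn0 hn0, pn]; decide)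
        (by rw [R1, qrBit_mul ℓ two_ne_zero (mul_ne_zero hn0 hn0), qrBit_mul_self, add_zero]
            exact add_self_zmod2 _)
    · rw [show (-(n : ℚ) - 0) = -1 * (n : ℚ) by ring]
      exact sq hb0 (mul_ne_zero (by norm_num) hn0)
        (by rw [hβ, parityBit_mul (by norm_num) hn0, pm1, pn]; decide)
        (by rw [R2, qrBit_mul ℓ (by norm_num) hn0]; exact add_self_zmod2 _)
  · -- `(1, 0)`: the point `T₂ = (0, 0)`, descent values `(n, −n²)`
    refine twoDescentClass_mem_selmerLocalKer_of_isSquare_T₂ W hT _ (charZero_adicCompletion_rat v) a b ?_ ?_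
    · rw [show (0 : ℚ) - -(n : ℚ) = (n : ℚ) by ring]
      exact sq ha0 hn0 (by rw [hα, pn]; decide) (by rw [R1]; exact add_self_zmod2 _)
    · rw [show ((0 : ℚ) - -(n : ℚ)) * (0 - (n : ℚ)) = -1 * ((n : ℚ) * n) by ring]
      exact sq hb0 (mul_ne_zero (by norm_num) (mul_ne_zero hn0 hn0))
        (by rw [hβ, parityBit_mul (by norm_num) (mul_ne_zero hn0 hn0), pm1, parityBit_mul hn0 hn0, pn]; decide)
        (by rw [R2, qrBit_mul ℓ (by norm_num) (mul_ne_zero hn0 hn0), qrBit_mul_self, add_zero]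
            exact add_self_zmod2 _)
  · -- `(1, 1)`: the point `T₃ = (n, 0)`, descent values `(2n, n)`
    refine twoDescentClass_mem_selmerLocalKer_of_isSquare_T₃ W hT _ (charZero_adicCompletion_rat v) a b ?_ ?_
    · rw [show (n : ℚ) - -(n : ℚ) = 2 * (n : ℚ) by ring]
      exact sq ha0 (mul_ne_zero two_ne_zero hn0)
        (by rw [hα, parityBit_mul two_ne_zero hn0, p2, pn]; decide)
        (by rw [R1, qrBit_mul ℓ two_ne_zero hn0,
              show ∀ x y : ZMod 2, x + y + (y + x) = (x + x) + (y + y) from fun x y => by ring,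
              add_self_zmod2, add_self_zmod2, add_zero])
    · rw [show (n : ℚ) - 0 = (n : ℚ) by ring]
      exact sq hb0 hn0 (by rw [hβ, pn]; decide)
        (by rw [R2, show ∀ x y : ZMod 2, x + (x + y) + y = (x + x) + (y + y) from fun x y => by ring,
              add_self_zmod2, add_self_zmod2, add_zero])

/-! ## §3 The prime `2` for `n ≡ 2 (mod 4)` -/

/-- **The prime `2`, case `([a]₂, [b]₂) = (1, 1)`**: for odd `a, b` (`v₂ = 0`) with `a ≡ b ≡ 1 (mod 8)`
(`res8 = 1`), `c(a, b)` satisfies the local Selmer condition at the place above `2` (the point `O`).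
[cite: SilvermanAEC2009, Prop. X.1.4, Example X.1.5] [cite: Serre1973, Ch. II §3.3 Thm 4] -/
theorem twoDescentClass_mem_selmerLocalKer_two_of_res8_eq_one (v : HeightOneSpectrum (𝓞 ℚ))
    (hv : (primesEquiv v : ℕ) = 2) (a b : ℚˣ) (hva : padicValRat 2 (a : ℚ) = 0) (hvb : padicValRat 2 (b : ℚ) = 0)
    (h8a : res8 (a : ℚ) = 1) (h8b : res8 (b : ℚ) = 1) :
    (congruentNumberCurve n).twoDescentClass (splitTwoTorsion_cn n) a b ∈
      selmerLocalKer (congruentNumberCurve n) (v.adicCompletion ℚ) 2 :=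
  twoDescentClass_mem_selmerLocalKer_of_isSquare (congruentNumberCurve n) (splitTwoTorsion_cn n) _
    (charZero_adicCompletion_rat v) a b
    (isSquare_algebraMap_adicCompletion_two_of_res8 v hv a.ne_zero (by rw [hva]; exact ⟨0, rfl⟩) h8a)
    (isSquare_algebraMap_adicCompletion_two_of_res8 v hv b.ne_zero (by rw [hvb]; exact ⟨0, rfl⟩) h8b)

omit hE in
/-- `125 − 5n² ≡ 1 (mod 8)` for `n ≡ 2 (mod 4)`. [folklore] -/
private theorem mod_eight_aux (hn4 : n % 4 = 2) : ((125 : ℤ) - 5 * (n : ℤ) ^ 2) % 8 = 1 := by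
  obtain ⟨k, hk⟩ : ∃ k : ℕ, n = 4 * k + 2 := ⟨n / 4, by omega⟩
  subst hk
  push_cast
  have : (125 : ℤ) - 5 * (4 * (k : ℤ) + 2) ^ 2 = 8 * (13 - 10 * (k : ℤ) ^ 2 - 10 * k) + 1 := by ring
  rw [this]
  omega

omit hE in
/-- **The `2`-adic point `(5, √(125 − 5n²)) ∈ E_n(ℚ₂)` for `n ≡ 2 (mod 4)`** (`125 − 5n² ≡ 1 (mod 8)` is a
`2`-adic square; Aoki 1999 Thm 3.1 (2): `x = 5/t²`), realised in the tree's completion `ℚ_v`, `v ∣ 2`: there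
is `y ∈ ℚ_v` with `y² = 125 − 5n²`. [cite: Serre1973, Ch. II §3.3 Thm 4] [cite: SilvermanAEC2009, Example X.1.5] -/
theorem exists_mul_self_eq_two (v : HeightOneSpectrum (𝓞 ℚ)) (hv : (primesEquiv v : ℕ) = 2) (hn4 : n % 4 = 2) :
    ∃ y : v.adicCompletion ℚ, algebraMap ℚ (v.adicCompletion ℚ) (125 - 5 * (n : ℚ) ^ 2) = y * y := by
  haveI : Fact (Nat.Prime 2) := ⟨Nat.prime_two⟩
  have hsq : IsSquare (algebraMap ℚ (v.adicCompletion ℚ) (((125 : ℤ) - 5 * (n : ℤ) ^ 2 : ℤ) : ℚ)) := by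
    apply isSquare_algebraMap_adicCompletion_of_padic' v hv
    rw [Rat.cast_intCast]
    exact padic_isSquare_intCast_of_mod_eight rfl (mod_eight_aux hn4)
  obtain ⟨y, hy⟩ := hsq
  refine ⟨y, ?_⟩
  rw [← hy]
  congr 1
  push_cast
  ring

/-- **The prime `2`, case `([a]₂, [b]₂) = ([5 + n], [5])`** (`n ≡ 2 (mod 4)`): for odd `a, b` with
`a·(5 + n) ≡ 1` and `5b ≡ 1 (mod 8)`, `c(a, b)` satisfies the local Selmer condition at the place above `2`
— `([a]₂, [b]₂)` is the descent pair `(x + n, x)` of the point `(5, √(125 − 5n²)) ∈ E_n(ℚ₂)`.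
[cite: SilvermanAEC2009, Prop. X.1.4, Example X.1.5] [cite: Serre1973, Ch. II §3.3 Thm 4] -/
theorem twoDescentClass_mem_selmerLocalKer_two_of_res8_mul_eq_one (v : HeightOneSpectrum (𝓞 ℚ))
    (hv : (primesEquiv v : ℕ) = 2) (hn4 : n % 4 = 2) (a b : ℚˣ) (hva : padicValRat 2 (a : ℚ) = 0)
    (hvb : padicValRat 2 (b : ℚ) = 0) (h8a : res8 ((a : ℚ) * (5 + n)) = 1) (h8b : res8 ((b : ℚ) * 5) = 1) :
    (congruentNumberCurve n).twoDescentClass (splitTwoTorsion_cn n) a b ∈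
      selmerLocalKer (congruentNumberCurve n) (v.adicCompletion ℚ) 2 := by
  haveI : Fact (Nat.Prime 2) := ⟨Nat.prime_two⟩
  set W := congruentNumberCurve n with hW
  have hT := splitTwoTorsion_cn n
  -- the point `(5, y)` over `ℚ_v`, `v ∣ 2`
  obtain ⟨y, hy⟩ := exists_mul_self_eq_two v hv hn4
  have heq : (W.baseChange (v.adicCompletion ℚ)).toAffine.Equation (algebraMap ℚ (v.adicCompletion ℚ) 5) y := by
    rw [WeierstrassCurve.Affine.equation_iff]
    have e1 : (W.baseChange (v.adicCompletion ℚ)).toAffine.a₁ = 0 := by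
      rw [hW]; simp [WeierstrassCurve.baseChange]
    have e2 : (W.baseChange (v.adicCompletion ℚ)).toAffine.a₂ = 0 := by
      rw [hW]; simp [WeierstrassCurve.baseChange]
    have e3 : (W.baseChange (v.adicCompletion ℚ)).toAffine.a₃ = 0 := by
      rw [hW]; simp [WeierstrassCurve.baseChange]
    have e4 : (W.baseChange (v.adicCompletion ℚ)).toAffine.a₄ = algebraMap ℚ (v.adicCompletion ℚ) (-((n : ℚ) ^ 2)) := by
      rw [hW]; simp [WeierstrassCurve.baseChange]
    have e6 : (W.baseChange (v.adicCompletion ℚ)).toAffine.a₆ = 0 := by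
      rw [hW]; simp [WeierstrassCurve.baseChange]
    rw [e1, e2, e3, e4, e6, sq, ← hy, ← map_pow, ← map_mul]
    simp only [zero_mul, add_zero, ← map_add]
    congr 1
    ring
  have hn2 : ¬ (2 : ℤ) ∣ (5 + (n : ℤ)) := by omega
  have h5n0 : (5 + (n : ℚ)) ≠ 0 := by positivity
  have sqa : IsSquare (algebraMap ℚ (v.adicCompletion ℚ) (a : ℚ) *
      (algebraMap ℚ (v.adicCompletion ℚ) 5 - algebraMap ℚ (v.adicCompletion ℚ) (-(n : ℚ)))) := by
    rw [← map_sub, ← map_mul, show (5 : ℚ) - -(n : ℚ) = 5 + n by ring]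
    refine isSquare_algebraMap_adicCompletion_two_of_res8 v hv (mul_ne_zero a.ne_zero h5n0) ?_ h8a
    rw [padicValRat.mul a.ne_zero h5n0, hva, zero_add,
      show (5 : ℚ) + n = ((5 + (n : ℤ) : ℤ) : ℚ) by push_cast; ring, padicValRat_intCast_eq_zero hn2]
    exact ⟨0, rfl⟩
  have sqb : IsSquare (algebraMap ℚ (v.adicCompletion ℚ) (b : ℚ) *
      (algebraMap ℚ (v.adicCompletion ℚ) 5 - algebraMap ℚ (v.adicCompletion ℚ) 0)) := by
    rw [← map_sub, ← map_mul, sub_zero]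
    refine isSquare_algebraMap_adicCompletion_two_of_res8 v hv (mul_ne_zero b.ne_zero (by norm_num)) ?_ h8b
    rw [padicValRat.mul b.ne_zero (by norm_num), hvb, zero_add,
      show (5 : ℚ) = ((5 : ℤ) : ℚ) by norm_num, padicValRat_intCast_eq_zero (by norm_num)]
    exact ⟨0, rfl⟩
  have hinj := (algebraMap ℚ (v.adicCompletion ℚ)).injective
  have hx₁ : algebraMap ℚ (v.adicCompletion ℚ) 5 ≠ algebraMap ℚ (v.adicCompletion ℚ) (-(n : ℚ)) := by
    intro h
    have h' := hinj h
    have : (0 : ℚ) ≤ n := Nat.cast_nonneg n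
    linarith
  have hx₂ : algebraMap ℚ (v.adicCompletion ℚ) 5 ≠ algebraMap ℚ (v.adicCompletion ℚ) 0 := by
    intro h; have h' := hinj h; norm_num at h'
  exact twoDescentClass_mem_selmerLocalKer_of_equation W hT _ (charZero_adicCompletion_rat v) a b heq hx₁ hx₂ sqa sqb

/-! ## §4 The real place -/

/-- **The real place**: for `a > 0` the class `c(a, b)` satisfies the local Selmer condition at the infinite
place (`([a]_∞, [b]_∞) = (+, +)` is the pair of `O`, `(+, −)` that of `T₂ = (0, 0)`, whose descent values are
`(n, −n²)`). [cite: SilvermanAEC2009, Prop. X.1.4] -/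
theorem twoDescentClass_mem_selmerLocalKer_infinitePlace_of_pos (hn : n ≠ 0) (w : InfinitePlace ℚ) (a b : ℚˣ)
    (ha : 0 < (a : ℚ)) :
    (congruentNumberCurve n).twoDescentClass (splitTwoTorsion_cn n) a b ∈
      selmerLocalKer (congruentNumberCurve n) w.Completion 2 := by
  set W := congruentNumberCurve n with hW
  have hT := splitTwoTorsion_cn n
  have hn0 : (0 : ℚ) < n := by exact_mod_cast Nat.pos_of_ne_zero hn
  rcases lt_or_gt_of_ne b.ne_zero with hb | hb
  · -- `b < 0`: the point `T₂`
    refine twoDescentClass_mem_selmerLocalKer_of_isSquare_T₂ W hT _ (charZero_completion_rat w) a b ?_ ?_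
    · exact isSquare_algebraMap_completion_of_pos w (by rw [show (0 : ℚ) - -(n : ℚ) = n by ring]; positivity)
    · refine isSquare_algebraMap_completion_of_pos w ?_
      rw [show ((0 : ℚ) - -(n : ℚ)) * (0 - (n : ℚ)) = -((n : ℚ) * n) by ring, mul_neg]
      exact neg_pos.mpr (mul_neg_of_neg_of_pos hb (by positivity))
  · -- `b > 0`: the point `O`
    exact twoDescentClass_mem_selmerLocalKer_of_isSquare W hT _ (charZero_completion_rat w) a b
      (isSquare_algebraMap_completion_of_pos w ha) (isSquare_algebraMap_completion_of_pos w hb)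

/-! ## §5 Assembly: `c(a, b) ∈ Sel⁽²⁾(E_n/ℚ)` -/

/-- **Local-to-global for the class of a pair** (Silverman X.1.4 / X.4.9: `Sel⁽²⁾` is cut out by the local
conditions at all places). Let `n ≠ 0`, `(a, b) = (m, m')` a pair of non-zero integers with `a > 0`, such
that: at every odd prime `ℓ ∤ n`, `ℓ ∤ m m'`; at every odd prime `ℓ ∣ n`, `v_ℓ(n) = 1` and the two relations
of §2 hold; and at the place above `2` the class satisfies the local condition. Then
`c(a, b) ∈ Sel⁽²⁾(E_n/ℚ)`. [cite: SilvermanAEC2009, Prop. X.1.4, Prop. X.4.9] -/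
theorem twoDescentClass_mem_selmerGroup_of_local (hn : n ≠ 0) (a b : ℚˣ) (m m' : ℤ) (hm : (a : ℚ) = m)
    (hm' : (b : ℚ) = m') (hpos : 0 < (a : ℚ))
    (hgood : ∀ ℓ : ℕ, ℓ.Prime → ℓ ≠ 2 → ¬ ℓ ∣ n → ¬ (ℓ : ℤ) ∣ m ∧ ¬ (ℓ : ℤ) ∣ m')
    (hbad : ∀ ℓ : ℕ, (hℓ : ℓ.Prime) → ℓ ≠ 2 → ℓ ∣ n → haveI : Fact ℓ.Prime := ⟨hℓ⟩
      padicValRat ℓ (n : ℚ) = 1 ∧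
      qrBit ℓ (a : ℚ) = parityBit ℓ (a : ℚ) * qrBit ℓ (n : ℚ) + parityBit ℓ (b : ℚ) * qrBit ℓ 2 ∧
      qrBit ℓ (b : ℚ) = parityBit ℓ (a : ℚ) * qrBit ℓ (-1) + parityBit ℓ (b : ℚ) * (qrBit ℓ (-1) + qrBit ℓ (n : ℚ)))
    (htwo : ∀ v : HeightOneSpectrum (𝓞 ℚ), (primesEquiv v : ℕ) = 2 →
      (congruentNumberCurve n).twoDescentClass (splitTwoTorsion_cn n) a b ∈
        selmerLocalKer (congruentNumberCurve n) (v.adicCompletion ℚ) 2) :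
    (congruentNumberCurve n).twoDescentClass (splitTwoTorsion_cn n) a b ∈ (congruentNumberCurve n).selmerGroup 2 := by
  rw [mem_selmerGroup_iff]
  refine ⟨fun v => ?_, fun w => twoDescentClass_mem_selmerLocalKer_infinitePlace_of_pos hn w a b hpos⟩
  haveI := fact_prime_primesEquiv v
  by_cases h2 : (primesEquiv v : ℕ) = 2
  · exact htwo v h2
  by_cases hdvd : (primesEquiv v : ℕ) ∣ n
  · obtain ⟨hv1, R1, R2⟩ := hbad _ (primesEquiv v).2 h2 hdvd
    exact twoDescentClass_mem_selmerLocalKer_of_qrBit_rel v rfl h2 hv1 a b R1 R2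
  · have hℓ : ¬ (primesEquiv v : ℕ) ∣ 2 * n := by
      intro h
      rcases (Nat.Prime.dvd_mul (primesEquiv v).2).mp h with h' | h'
      · exact h2 ((Nat.prime_dvd_prime_iff_eq (primesEquiv v).2 Nat.prime_two).mp h')
      · exact hdvd h'
    obtain ⟨hm1, hm2⟩ := hgood _ (primesEquiv v).2 h2 hdvd
    exact twoDescentClass_mem_selmerLocalKer_of_not_dvd v hℓ a b m m' hm hm' hm1 hm2

end CongruentNumberTwoDescent

end Literature.NumberTheory.EllipticCurves

end

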